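/-
Copyright (c) 2026. All rights reserved.
Released under Apache 2.0 license as described in the file LICENSE.
Authors: abc-iut cell, seat abc-iut-L4-t14 (gen 5; proof-only consumer assembly, rows «SURFACE-CONSUMER-PSL»
and «COCOMPACT-COLUMN»: [AbsTopIII] Prop 4.2 (i) «objects of EA mapping to X id-rigid» + Cor 4.5 at the
uniformised holomorphic model X = ℍ/Γ̄ for Γ̄ free-or-surface, and for COCOMPACT Γ̄ with the two
campaign-L residuals `hN`, `hfin` of the gen-3/4 columns DISCHARGED).
-/
import Literature.AnabelianGeometry.AbsoluteAnabelian.ArchimedeanHolFieldFunctorGeometricPSLSlim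
import Literature.AnabelianGeometry.AbsoluteAnabelian.ArchimedeanHolFieldFunctorGeometricPSLNormalizerFinite
import Literature.GroupTheory.SurfaceNormalSubgroupCompletionCentralizer
import Literature.IUT.HodgeTheaters.SurfaceGroupFiniteIndexDischarge
import Literature.IUT.HodgeTheaters.ProfiniteCompletionCommensurablyTerminal
import Literature.IUT.HodgeTheaters.DiscreteProfiniteConjugatesSurfaceHCS
import HarnessLib

/-!
# [AbsTopIII] Prop 4.2 (i) at the uniformised model for `Γ̄` free-or-surface; the COCOMPACT column

S. Mochizuki, *Topics in absolute anabelian geometry III*, proof of Prop 4.2 (i) p. 106 l. 14–19 (kurims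
`paper:url-5493eb38cbb7`; bib key `MochizukiAbsTopIII2015`): "the full subcategory of `EA` consisting of
objects that map to `X` may … be identified with the category of finite étale R-localizations `Loc_R(X)`
…. Thus, the id-rigidity of `EA` follows immediately from the slimness assertion of Lemma 4.3" — the
slimness of `Π_{[X/Aut X]}`, which at the uniformised model `X = ℍ/Λ̄` is the profinite completion of
`N_{PSL₂(ℝ)}(Λ̄)`, the finiteness of `Aut X = N(Λ̄)/Λ̄` being used on the way.

PROOF-ONLY consumer assembly (no definition, no named fact).  abc-iut-L4-t14's gen-3/4 columns
(`HolRS.isIdRigid_EA_mapsTo_pslQuotient`, p440736; `…_of_isFreeGroup`, p449027) proved the statement over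
`X₀ = ℍ/Γ̄` for `Γ̄` FREE of rank `≥ 2`, with two residual hypotheses: `hN : [N(Λ̄) : Λ̄] < ∞` for every
finite-index `Λ̄ ≤ Γ̄` (campaign-L «J2 (i)») and the finite-fibre hypothesis `hfin`.  Meanwhile the tree
acquired, BY NAME:

* abc-iut-L4-d1's `Literature.GroupTheory.isSlimGroup_completion_normalizer_of_isFreeOrSurface` (p449698):
  `N_N(Γ)^` is SLIM for `Γ ≤ N` free of finite rank OR an orientable surface group (abc-iut-L5's
  `IsFreeOrSurface`, "a group as in [IUTchI] Thm 2.6"), of finite index in `N_N(Γ)`, centraliser-free there;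
* abc-iut-L4-d1's `HolRS.finiteIndex_subgroupOf_normalizer_of_compactSpace` (p454159): `[N(Γ̄) : Γ̄] < ∞`
  for `Γ̄` non-abelian, properly discontinuous, with COMPACT `ℍ/Γ̄`, and
  `HolRS.compactSpace_orbitRelQuotient_of_finiteIndex` (cocompactness is inherited by finite index);
* abc-iut-L5's heredity `IsFreeOrSurface.subgroup_of_finiteIndex'` (Reidemeister–Schreier / Riemann–Hurwitz,
  `surfaceGroupFiniteIndexSubgroup_holds`) and `IsFreeOrSurface.exists_noncomm_of_finiteIndex`.

Results (all `Γ̄ ≤ PSL₂(ℝ)` acting freely and properly discontinuously on `ℍ`):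

* `HolRS.LocObj.isFreeOrSurface`, `….exists_mul_ne_mul_of_isFreeOrSurface`,
  `….isSlimGroup_completion_normalizer_of_isFreeOrSurface` — every object `Λ̄` of `Loc(PSL₂(ℝ), Γ̄)` is
  free-or-surface and non-abelian when `Γ̄` is, hence `N(Λ̄)^` is SLIM given `[N(Λ̄) : Λ̄] < ∞`
  (print's «slimness assertion of Lemma 4.3» for `[ (ℍ/Λ̄) / Aut(ℍ/Λ̄) ]`, object by object);
* ★ `HolRS.isIdRigid_EA_mapsTo_pslQuotient_of_isFreeOrSurface`, `HolRS.cor_4_5_geometric_mapsTo_pslQuotient_of_isFreeOrSurface`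
  — the gen-4 closers with `[IsFreeGroup Γ̄]` replaced by «`Γ̄` free of finite rank OR an orientable surface
  group, non-abelian»; hypotheses {`hfin`, `hN`};
* `HolRS.finiteIndex_conjSubgroup_subgroupOf_of_compactSpace` — **`hfin` HOLDS when `ℍ/Γ̄` is compact**: for
  `g ∈ PSL₂(ℝ)` and finite-index `Λ̄₁, Λ̄₂ ≤ Γ̄` with `gΛ̄₁g⁻¹ ≤ Λ̄₂`, the index `[Λ̄₂ : gΛ̄₁g⁻¹]` is finite (a
  compact `K` with `Λ̄₁K = ℍ` gives `(gΛ̄₁g⁻¹)(gK) = ℍ`; the finitely many `γ ∈ Λ̄₂` with `γ i ∈ gK` — proper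
  discontinuity — meet every coset);
* `HolRS.LocObj.finiteIndex_subgroupOf_normalizer_of_compactSpace` — **`hN` HOLDS when `ℍ/Γ̄` is compact**
  (abc-iut-L4-d1's theorem at every object);
* ★★ `HolRS.isIdRigid_EA_mapsTo_pslQuotient_of_compactSpace` /
  `HolRS.isIdRigid_EA_mapsTo_pslQuotient_of_isOrientableSurfaceGroup` and the Cor 4.5 twins — **for a
  COMPACT hyperbolic Riemann surface `X₀ = ℍ/Γ̄`, `Γ̄` an orientable surface group acting freely, properly
  discontinuously and cocompactly, the geometric `EA` over `X₀` is ID-RIGID and [AbsTopIII] Cor 4.5 (i)–(v)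
  holds for its archimedean log-Frobenius data — with NO residual hypothesis** (structural data only).

HONEST SCOPE.  MODEL side of [AbsTopIII] §4 (model ≠ reconstruction); holomorphic morphisms (the
print-faithful RC twin is a separate file); «cocompact torsion-free Fuchsian ⇒ orientable surface group»
(surface classification) is NOT derived — `IsOrientableSurfaceGroup Γ̄` / `IsFreeOrSurface Γ̄` stays a
structural hypothesis (its free branch is vacuous under cocompactness); no cocompact `Γ̄` is constructed in
the tree (arithmetic Fuchsian groups: campaign-L), so non-vacuity of ★★ is classical, not kernel-witnessed;
orbi objects and `EA` beyond one `X₀` untouched.  Classical; nothing here bears on [IUTchIII] Cor. 3.12.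
-/

set_option autoImplicit false

noncomputable section

open scoped UpperHalfPlane MatrixGroups Pointwise
open _root_.MulAction _root_.CategoryTheory
open _root_.ProfiniteGrp.ProfiniteCompletion (completion)
open Literature.AlgebraicGeometry.Frobenioids (IsSlimGroup)
open Literature.IUT.HodgeTheaters (IsFreeOrSurface IsOrientableSurfaceGroup)
open Literature.Geometry.Manifold.QuotientManifold (conjSubgroup conj_mem_conjSubgroup)

namespace Literature.AnabelianGeometry.AbsoluteAnabelian

namespace HolRS

/-! ### Part 1 — the objects of `Loc(PSL₂(ℝ), Γ̄)` for `Γ̄` free-or-surface -/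

/-- An orientable surface group is non-abelian (abc-iut-L5: two non-commuting elements even inside the
commutator subgroup). [cite: Mochizuki2012, Lem 2.7(vi) p.59] -/
theorem exists_mul_ne_mul_of_isOrientableSurfaceGroup (Γ : Subgroup PSL2R)
    (hΓ : IsOrientableSurfaceGroup Γ) : ∃ a b : Γ, a * b ≠ b * a := by
  obtain ⟨x, -, y, -, hxy⟩ :=
    Literature.IUT.HodgeTheaters.FreeOrSurface.exists_noncomm_mem_commutator_surfaceCase Γ hΓ
  exact ⟨x, y, hxy⟩

namespace LocObj

variable {Γ : Subgroup PSL2R}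

/-- **Every object `Λ̄` of `Loc(PSL₂(ℝ), Γ̄)` is free of finite rank or an orientable surface group** when
`Γ̄` is (finite index: Nielsen–Schreier, resp. Reidemeister–Schreier / Riemann–Hurwitz — abc-iut-L5's
`IsFreeOrSurface.subgroup_of_finiteIndex'`). [cite: ZieschangVogtColdewey1980, §4.14 Prop 4.14.23] -/
theorem isFreeOrSurface (hΓ : IsFreeOrSurface Γ)
    (Λ : _root_.Literature.AnabelianGeometry.AbsoluteAnabelian.LocObj Γ) :
    IsFreeOrSurface Λ.toSubgroup := by
  let K : Subgroup Γ := Λ.toSubgroup.subgroupOf Γ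
  haveI : K.FiniteIndex := Λ.finiteIndex
  have hK : IsFreeOrSurface K := hΓ.subgroup_of_finiteIndex' K
  exact Literature.IUT.HodgeTheaters.IsFreeOrSurface.of_mulEquiv
    (Subgroup.subgroupOfEquivOfLe Λ.le).symm hK

/-- **Every object `Λ̄` of `Loc(PSL₂(ℝ), Γ̄)` is an orientable surface group** when `Γ̄` is
(Riemann–Hurwitz, abc-iut-L5's `IsOrientableSurfaceGroup.subgroup_of_finiteIndex'`).
[cite: ZieschangVogtColdewey1980, §4.14 Prop 4.14.23] -/
theorem isOrientableSurfaceGroup (hΓ : IsOrientableSurfaceGroup Γ)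
    (Λ : _root_.Literature.AnabelianGeometry.AbsoluteAnabelian.LocObj Γ) :
    IsOrientableSurfaceGroup Λ.toSubgroup := by
  let K : Subgroup Γ := Λ.toSubgroup.subgroupOf Γ
  haveI : K.FiniteIndex := Λ.finiteIndex
  have hK : IsOrientableSurfaceGroup K := hΓ.subgroup_of_finiteIndex' K
  exact Literature.IUT.HodgeTheaters.IsOrientableSurfaceGroup.of_mulEquiv
    (Subgroup.subgroupOfEquivOfLe Λ.le).symm hK

/-- **Every object `Λ̄` of `Loc(PSL₂(ℝ), Γ̄)` is non-abelian** when `Γ̄` is free-or-surface and non-abelian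
(abc-iut-L5's `IsFreeOrSurface.exists_noncomm_of_finiteIndex`, [IUTchI] Lem 2.7 (iii)(iv)).
[cite: Mochizuki2012, Lem 2.7(iii)(iv) p.57] -/
theorem exists_mul_ne_mul_of_isFreeOrSurface (hΓ : IsFreeOrSurface Γ) (hab : ∃ a b : Γ, a * b ≠ b * a)
    (Λ : _root_.Literature.AnabelianGeometry.AbsoluteAnabelian.LocObj Γ) :
    ∃ x y : Λ.toSubgroup, x * y ≠ y * x := by
  obtain ⟨a, b, hab⟩ := hab
  let K : Subgroup Γ := Λ.toSubgroup.subgroupOf Γ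
  haveI : K.FiniteIndex := Λ.finiteIndex
  obtain ⟨x, hx, y, hy, hxy⟩ := hΓ.exists_noncomm_of_finiteIndex hab K
  refine ⟨⟨(x : PSL2R), Subgroup.mem_subgroupOf.mp hx⟩, ⟨(y : PSL2R), Subgroup.mem_subgroupOf.mp hy⟩,
    fun h => hxy ?_⟩
  exact Subtype.ext (congrArg (fun z : Λ.toSubgroup => (z : PSL2R)) h)

/-- ★ **`N(Λ̄)^` is SLIM for every object `Λ̄` of `Loc(PSL₂(ℝ), Γ̄)`** with `[N(Λ̄) : Λ̄] < ∞`, for `Γ̄`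
free-or-surface, non-abelian, acting freely on `ℍ` — print's «slimness assertion of Lemma 4.3» for
`Π_{[(ℍ/Λ̄)/Aut(ℍ/Λ̄)]} = N_{PSL₂(ℝ)}(Λ̄)^`, by abc-iut-L4-d1's
`isSlimGroup_completion_normalizer_of_isFreeOrSurface` with the inputs `isFreeOrSurface` (above) and
`C_{PSL₂(ℝ)}(Λ̄) = 1` (`psl_centralizer_eq_bot`, via `forall_mem_normalizer_comm_eq_one`).
[cite: MochizukiAbsTopIII2015, Lemma 4.3 p.106] -/
theorem isSlimGroup_completion_normalizer_of_isFreeOrSurface [IsCancelSMul Γ ℍ]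
    (hΓ : IsFreeOrSurface Γ) (hab : ∃ a b : Γ, a * b ≠ b * a)
    (Λ : _root_.Literature.AnabelianGeometry.AbsoluteAnabelian.LocObj Γ)
    [(Λ.toSubgroup.subgroupOf (Subgroup.normalizer (Λ.toSubgroup : Set PSL2R))).FiniteIndex] :
    IsSlimGroup (completion (GrpCat.of (Subgroup.normalizer (Λ.toSubgroup : Set PSL2R)))) := by
  haveI : IsCancelSMul Λ.toSubgroup ℍ := isCancelSMul_of_le upperHalfPlane Γ Λ.le
  exact Literature.GroupTheory.isSlimGroup_completion_normalizer_of_isFreeOrSurface Λ.toSubgroup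
    (isFreeOrSurface hΓ Λ)
    (forall_mem_normalizer_comm_eq_one Λ.toSubgroup (exists_mul_ne_mul_of_isFreeOrSurface hΓ hab Λ))

end LocObj

/-! ### Part 2 — the holomorphic geometric column for `Γ̄` free-or-surface -/

section Column

variable (Γ : Subgroup PSL2R) [ProperlyDiscontinuousSMul Γ ℍ] [IsCancelSMul Γ ℍ]
  (hfin : ∀ (g : PSL2R) (Λ₁ Λ₂ : _root_.Literature.AnabelianGeometry.AbsoluteAnabelian.LocObj Γ),
    (∀ x ∈ Λ₁.toSubgroup, g * x * g⁻¹ ∈ Λ₂.toSubgroup) →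
    ((conjSubgroup g Λ₁.toSubgroup).subgroupOf Λ₂.toSubgroup).FiniteIndex)

include hfin in
/-- **«Objects of `HolRS` mapping to `ℍ/Γ̄`» is id-rigid** for `Γ̄` free-or-surface, non-abelian, acting
freely and properly discontinuously on `ℍ` with `[N(Γ̄) : Γ̄] < ∞` (p440098 with the Lemma 4.3 input at
the object `Γ̄` itself PROVED). [cite: MochizukiAbsTopIII2015, Proposition 4.2 (i) proof p.106] -/
theorem isIdRigid_mapsTo_pslQuotient_of_isFreeOrSurface (hΓ : IsFreeOrSurface Γ)
    (hab : ∃ a b : Γ, a * b ≠ b * a)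
    [(Γ.subgroupOf (Subgroup.normalizer (Γ : Set PSL2R))).FiniteIndex] :
    IsIdRigid (ObjectProperty.FullSubcategory fun Y : HolRS => Nonempty (Y ⟶ pslQuotient Γ)) :=
  isIdRigid_mapsTo_pslQuotient_of_isSlimGroup Γ hfin
    (LocObj.isSlimGroup_completion_normalizer_of_isFreeOrSurface hΓ hab ⟨Γ, le_rfl, by
      rw [Subgroup.subgroupOf_self]; infer_instance⟩)

include hfin in
/-- ★ **The geometric `EA` over `X₀ = ℍ/Γ̄` is ID-RIGID for `Γ̄` free of finite rank or an orientable
surface group**, non-abelian, acting freely and properly discontinuously on `ℍ`, provided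
`[N(Λ̄) : Λ̄] < ∞` for every finite-index `Λ̄ ≤ Γ̄` — [AbsTopIII] Prop 4.2 (i) at the uniformised
holomorphic model (p440736 with its slimness hypothesis DISCHARGED object by object).
[cite: MochizukiAbsTopIII2015, Proposition 4.2 (i) proof p.106] -/
theorem isIdRigid_EA_mapsTo_pslQuotient_of_isFreeOrSurface (hΓ : IsFreeOrSurface Γ)
    (hab : ∃ a b : Γ, a * b ≠ b * a)
    (hN : ∀ Λ : _root_.Literature.AnabelianGeometry.AbsoluteAnabelian.LocObj Γ,
      (Λ.toSubgroup.subgroupOf (Subgroup.normalizer (Λ.toSubgroup : Set PSL2R))).FiniteIndex) :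
    IsIdRigid (geometricAutHolFieldFunctor fun Y : HolRS => Nonempty (Y ⟶ pslQuotient Γ)).EA :=
  isIdRigid_EA_mapsTo_pslQuotient Γ hfin hN fun Λ =>
    haveI := hN Λ
    LocObj.isSlimGroup_completion_normalizer_of_isFreeOrSurface hΓ hab Λ

include hfin in
/-- ★ **[AbsTopIII] Cor 4.5 (i)–(v) for the archimedean log-Frobenius data over the geometric `EA` of
connected Riemann surfaces finite étale over `ℍ/Γ̄`**, `Γ̄` free-or-surface and non-abelian, under the
single finiteness hypothesis `[N(Λ̄) : Λ̄] < ∞`. [cite: MochizukiAbsTopIII2015, Corollary 4.5 pp.107–109] -/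
theorem cor_4_5_geometric_mapsTo_pslQuotient_of_isFreeOrSurface (hΓ : IsFreeOrSurface Γ)
    (hab : ∃ a b : Γ, a * b ≠ b * a)
    (hN : ∀ Λ : _root_.Literature.AnabelianGeometry.AbsoluteAnabelian.LocObj Γ,
      (Λ.toSubgroup.subgroupOf (Subgroup.normalizer (Λ.toSubgroup : Set PSL2R))).FiniteIndex) :
    Literature.AnabelianGeometry.AbsoluteAnabelian.AbsTopIII.Cor_4_5
      (archLogFrobeniusData (geometricAutHolFieldFunctor fun Y : HolRS => Nonempty (Y ⟶ pslQuotient Γ)))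
      (archTelecoreData (geometricAutHolFieldFunctor fun Y : HolRS => Nonempty (Y ⟶ pslQuotient Γ))) :=
  cor_4_5_geometric_mapsTo_pslQuotient Γ hfin hN fun Λ =>
    haveI := hN Λ
    LocObj.isSlimGroup_completion_normalizer_of_isFreeOrSurface hΓ hab Λ

end Column

/-! ### Part 3 — the COCOMPACT column: `hfin` and `hN` discharged -/

section Cocompact

variable (Γ : Subgroup PSL2R) [ProperlyDiscontinuousSMul Γ ℍ]

/-- **`hfin` HOLDS for cocompact `Γ̄`.**  For `Γ̄ ≤ PSL₂(ℝ)` properly discontinuous with compact `ℍ/Γ̄`,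
`g ∈ PSL₂(ℝ)` and finite-index `Λ̄₁, Λ̄₂ ≤ Γ̄` with `gΛ̄₁g⁻¹ ≤ Λ̄₂`, the index `[Λ̄₂ : gΛ̄₁g⁻¹]` is
FINITE: `ℍ/Λ̄₁` is compact, so `Λ̄₁K = ℍ` for a compact `K` and `(gΛ̄₁g⁻¹)(gK) = ℍ`; by proper
discontinuity only finitely many `γ ∈ Λ̄₂` move `i` into `gK`, and every coset `(gΛ̄₁g⁻¹)k` contains one
of them.  (The finite-fibre hypothesis of abc-iut-L4-t14's `pslLocFunctor`, i.e. «the maps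
`ℍ/gΛ̄₁g⁻¹ → ℍ/Λ̄₂` are FINITE étale».) [cite: MochizukiAbsTopIII2015, Proposition 4.2 (i) proof p.106] -/
theorem finiteIndex_conjSubgroup_subgroupOf_of_compactSpace [CompactSpace (orbitRel.Quotient Γ ℍ)]
    (g : PSL2R) (Λ₁ Λ₂ : _root_.Literature.AnabelianGeometry.AbsoluteAnabelian.LocObj Γ)
    (hg : ∀ x ∈ Λ₁.toSubgroup, g * x * g⁻¹ ∈ Λ₂.toSubgroup) :
    ((conjSubgroup g Λ₁.toSubgroup).subgroupOf Λ₂.toSubgroup).FiniteIndex := by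
  classical
  set H : Subgroup PSL2R := conjSubgroup g Λ₁.toSubgroup with hHdef
  have hHle : H ≤ Λ₂.toSubgroup := by
    intro y hy
    obtain ⟨x, hx, rfl⟩ := Subgroup.mem_map.mp hy
    exact hg x hx
  -- `ℍ/Λ̄₁` is compact: a compact `K` with `Λ̄₁ K = ℍ`
  haveI : (Λ₁.toSubgroup.subgroupOf Γ).FiniteIndex := Λ₁.finiteIndex
  haveI : CompactSpace (orbitRel.Quotient Λ₁.toSubgroup ℍ) :=
    compactSpace_orbitRelQuotient_of_finiteIndex Γ Λ₁.toSubgroup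
  obtain ⟨K, hKc, hK⟩ := exists_isCompact_forall_exists_smul_mem Λ₁.toSubgroup
  -- `H (g K) = ℍ`
  have hK' : ∀ τ : ℍ, ∃ h ∈ H, h • τ ∈ g • K := by
    intro τ
    obtain ⟨l, hl⟩ := hK (g⁻¹ • τ)
    refine ⟨g * (l : PSL2R) * g⁻¹, conj_mem_conjSubgroup g Λ₁.toSubgroup _ l.2, ?_⟩
    have : (g * (l : PSL2R) * g⁻¹) • τ = g • ((l : PSL2R) • (g⁻¹ • τ)) := by rw [mul_smul, mul_smul]
    rw [this]
    exact Set.smul_mem_smul_set hl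
  -- finitely many `γ ∈ Λ̄₂` move `i` into `g K`
  haveI : ProperlyDiscontinuousSMul Λ₂.toSubgroup ℍ :=
    Subgroup.properlyDiscontinuousSMul_of_le ‹ProperlyDiscontinuousSMul Γ ℍ› Λ₂.le
  have hSfin : {γ : Λ₂.toSubgroup |
      ((γ • ·) '' {(UpperHalfPlane.I : ℍ)} ∩ g • K).Nonempty}.Finite :=
    ProperlyDiscontinuousSMul.finite_disjoint_inter_image isCompact_singleton (hKc.smul g)
  -- every left coset `k H` of `H` in `Λ̄₂` is `s⁻¹ H` for such a `γ = s`
  haveI : Finite (Λ₂.toSubgroup ⧸ H.subgroupOf Λ₂.toSubgroup) := by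
    haveI := hSfin.to_subtype
    let f : {γ : Λ₂.toSubgroup | ((γ • ·) '' {(UpperHalfPlane.I : ℍ)} ∩ g • K).Nonempty} →
        Λ₂.toSubgroup ⧸ H.subgroupOf Λ₂.toSubgroup := fun s => QuotientGroup.mk (s.1⁻¹)
    refine Finite.of_surjective f fun q => ?_
    obtain ⟨k, rfl⟩ := QuotientGroup.mk_surjective q
    obtain ⟨h, hh, hhk⟩ := hK' ((k : PSL2R)⁻¹ • UpperHalfPlane.I)
    -- `s := h k⁻¹ ∈ Λ̄₂` moves `i` into `g K`
    let s : Λ₂.toSubgroup :=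
      ⟨h * (k : PSL2R)⁻¹, Λ₂.toSubgroup.mul_mem (hHle hh) (Λ₂.toSubgroup.inv_mem k.2)⟩
    have hs : ((s • ·) '' {(UpperHalfPlane.I : ℍ)} ∩ g • K).Nonempty := by
      refine ⟨s • UpperHalfPlane.I, ⟨UpperHalfPlane.I, rfl, rfl⟩, ?_⟩
      change (h * (k : PSL2R)⁻¹) • UpperHalfPlane.I ∈ g • K
      rwa [mul_smul]
    refine ⟨⟨s, hs⟩, ?_⟩
    -- `k H = s⁻¹ H` since `k⁻¹ s⁻¹ = h⁻¹ ∈ H`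
    change (QuotientGroup.mk (s⁻¹) : Λ₂.toSubgroup ⧸ H.subgroupOf Λ₂.toSubgroup) = QuotientGroup.mk k
    symm
    rw [QuotientGroup.eq, Subgroup.mem_subgroupOf]
    have : (((k⁻¹ * s⁻¹ : Λ₂.toSubgroup)) : PSL2R) = h⁻¹ := by
      change (k : PSL2R)⁻¹ * (h * (k : PSL2R)⁻¹)⁻¹ = h⁻¹
      group
    rw [this]
    exact H.inv_mem hh
  exact Subgroup.finiteIndex_of_finite_quotient

variable {Γ} in
/-- **`hN` HOLDS for cocompact `Γ̄`, at every object**: for `Γ̄` free-or-surface, non-abelian, properly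
discontinuous with compact `ℍ/Γ̄`, every finite-index `Λ̄ ≤ Γ̄` has `[N_{PSL₂(ℝ)}(Λ̄) : Λ̄] < ∞`
(abc-iut-L4-d1's `finiteIndex_subgroupOf_normalizer_of_compactSpace` for `Λ̄`: `ℍ/Λ̄` is compact by
`compactSpace_orbitRelQuotient_of_finiteIndex`, `Λ̄` is non-abelian by Part 1).
[cite: MochizukiAbsTopIII2015, Proposition 4.2 (i) proof p.106] -/
theorem LocObj.finiteIndex_subgroupOf_normalizer_of_compactSpace [CompactSpace (orbitRel.Quotient Γ ℍ)]
    (hΓ : IsFreeOrSurface Γ) (hab : ∃ a b : Γ, a * b ≠ b * a)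
    (Λ : _root_.Literature.AnabelianGeometry.AbsoluteAnabelian.LocObj Γ) :
    (Λ.toSubgroup.subgroupOf (Subgroup.normalizer (Λ.toSubgroup : Set PSL2R))).FiniteIndex := by
  haveI : ProperlyDiscontinuousSMul Λ.toSubgroup ℍ :=
    Subgroup.properlyDiscontinuousSMul_of_le ‹ProperlyDiscontinuousSMul Γ ℍ› Λ.le
  haveI : (Λ.toSubgroup.subgroupOf Γ).FiniteIndex := Λ.finiteIndex
  haveI : CompactSpace (orbitRel.Quotient Λ.toSubgroup ℍ) :=
    compactSpace_orbitRelQuotient_of_finiteIndex Γ Λ.toSubgroup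
  exact HolRS.finiteIndex_subgroupOf_normalizer_of_compactSpace Λ.toSubgroup
    (LocObj.exists_mul_ne_mul_of_isFreeOrSurface hΓ hab Λ)

variable [IsCancelSMul Γ ℍ]

/-- **«Objects of `HolRS` mapping to a COMPACT `X₀ = ℍ/Γ̄`» is id-rigid**, `Γ̄` free-or-surface and
non-abelian acting freely, properly discontinuously and cocompactly — no residual hypothesis.
[cite: MochizukiAbsTopIII2015, Proposition 4.2 (i) proof p.106] -/
theorem isIdRigid_mapsTo_pslQuotient_of_compactSpace [CompactSpace (orbitRel.Quotient Γ ℍ)]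
    (hΓ : IsFreeOrSurface Γ) (hab : ∃ a b : Γ, a * b ≠ b * a) :
    IsIdRigid (ObjectProperty.FullSubcategory fun Y : HolRS => Nonempty (Y ⟶ pslQuotient Γ)) := by
  haveI := LocObj.finiteIndex_subgroupOf_normalizer_of_compactSpace hΓ hab
    ⟨Γ, le_rfl, by rw [Subgroup.subgroupOf_self]; infer_instance⟩
  exact isIdRigid_mapsTo_pslQuotient_of_isFreeOrSurface Γ
    (finiteIndex_conjSubgroup_subgroupOf_of_compactSpace Γ) hΓ hab

/-- ★★ **[AbsTopIII] Prop 4.2 (i) at the uniformised model for COMPACT `X₀`: the geometric `EA` over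
`X₀ = ℍ/Γ̄` is ID-RIGID**, for `Γ̄ ≤ PSL₂(ℝ)` free of finite rank or an orientable surface group,
non-abelian, acting freely, properly discontinuously and COCOMPACTLY on `ℍ` — both residual hypotheses of
the gen-3/4 columns (`hfin`, `hN`) DISCHARGED. [cite: MochizukiAbsTopIII2015, Proposition 4.2 (i) proof p.106] -/
theorem isIdRigid_EA_mapsTo_pslQuotient_of_compactSpace [CompactSpace (orbitRel.Quotient Γ ℍ)]
    (hΓ : IsFreeOrSurface Γ) (hab : ∃ a b : Γ, a * b ≠ b * a) :
    IsIdRigid (geometricAutHolFieldFunctor fun Y : HolRS => Nonempty (Y ⟶ pslQuotient Γ)).EA :=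
  isIdRigid_EA_mapsTo_pslQuotient_of_isFreeOrSurface Γ
    (finiteIndex_conjSubgroup_subgroupOf_of_compactSpace Γ) hΓ hab
    (LocObj.finiteIndex_subgroupOf_normalizer_of_compactSpace hΓ hab)

/-- ★★ **The same for `Γ̄` an orientable surface group** (genus `≥ 2`; non-abelian automatically): the
geometric `EA` over the compact hyperbolic Riemann surface `X₀ = ℍ/Γ̄` is ID-RIGID — hypotheses =
structural data only. [cite: MochizukiAbsTopIII2015, Proposition 4.2 (i) proof p.106] -/
theorem isIdRigid_EA_mapsTo_pslQuotient_of_isOrientableSurfaceGroup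
    [CompactSpace (orbitRel.Quotient Γ ℍ)] (hΓ : IsOrientableSurfaceGroup Γ) :
    IsIdRigid (geometricAutHolFieldFunctor fun Y : HolRS => Nonempty (Y ⟶ pslQuotient Γ)).EA :=
  isIdRigid_EA_mapsTo_pslQuotient_of_compactSpace Γ (Or.inr hΓ)
    (exists_mul_ne_mul_of_isOrientableSurfaceGroup Γ hΓ)

/-- ★★ **[AbsTopIII] Cor 4.5 (i)–(v) over a COMPACT `X₀ = ℍ/Γ̄`**, `Γ̄` free-or-surface, non-abelian,
acting freely, properly discontinuously and cocompactly — no residual hypothesis.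
[cite: MochizukiAbsTopIII2015, Corollary 4.5 pp.107–109] -/
theorem cor_4_5_geometric_mapsTo_pslQuotient_of_compactSpace [CompactSpace (orbitRel.Quotient Γ ℍ)]
    (hΓ : IsFreeOrSurface Γ) (hab : ∃ a b : Γ, a * b ≠ b * a) :
    Literature.AnabelianGeometry.AbsoluteAnabelian.AbsTopIII.Cor_4_5
      (archLogFrobeniusData (geometricAutHolFieldFunctor fun Y : HolRS => Nonempty (Y ⟶ pslQuotient Γ)))
      (archTelecoreData (geometricAutHolFieldFunctor fun Y : HolRS => Nonempty (Y ⟶ pslQuotient Γ))) :=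
  cor_4_5_geometric_mapsTo_pslQuotient_of_isFreeOrSurface Γ
    (finiteIndex_conjSubgroup_subgroupOf_of_compactSpace Γ) hΓ hab
    (LocObj.finiteIndex_subgroupOf_normalizer_of_compactSpace hΓ hab)

/-- ★★ **[AbsTopIII] Cor 4.5 (i)–(v) over the compact hyperbolic Riemann surface `X₀ = ℍ/Γ̄`, `Γ̄` an
orientable surface group** acting freely, properly discontinuously and cocompactly — structural data only.
[cite: MochizukiAbsTopIII2015, Corollary 4.5 pp.107–109] -/
theorem cor_4_5_geometric_mapsTo_pslQuotient_of_isOrientableSurfaceGroup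
    [CompactSpace (orbitRel.Quotient Γ ℍ)] (hΓ : IsOrientableSurfaceGroup Γ) :
    Literature.AnabelianGeometry.AbsoluteAnabelian.AbsTopIII.Cor_4_5
      (archLogFrobeniusData (geometricAutHolFieldFunctor fun Y : HolRS => Nonempty (Y ⟶ pslQuotient Γ)))
      (archTelecoreData (geometricAutHolFieldFunctor fun Y : HolRS => Nonempty (Y ⟶ pslQuotient Γ))) :=
  cor_4_5_geometric_mapsTo_pslQuotient_of_compactSpace Γ (Or.inr hΓ)
    (exists_mul_ne_mul_of_isOrientableSurfaceGroup Γ hΓ)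

end Cocompact

end HolRS

end Literature.AnabelianGeometry.AbsoluteAnabelian

end
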